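import Mathlib
import Summits.ValiantsHypothesis.ValiantsHypothesis.Theorems.FifoMatchingNNLinearDegreeCofactorHardGateWeight
import HarnessLib

/-!
# Crux `NNLinearDegreeCofactorHard` (stmt-ValiantsHypothesis-23918), line `internal_cofactor`, rung S11
# (stmt-ValiantsHypothesis-24468): the gate weight for a TARGET SET of pop counts

`…GateWeight.lean` (p597876) prices a past-chosen window of `ℓ` pairs whose pop count must hit ONE past-chosen value.  The
gate-span lemma of the dichotomy (D‴)/(D*) (`Lines/internal_cofactor-S2b-D3architecture-p2.md` §3) delivers a target SET of
`≤ 2d+3` values (alignment within `d` tests).  This file is the set version, with the same three properties: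

* `sum_completions_setPair` — the exported recursion `Σ_c N_{t+1}(v[pair s+t := c]) = N_t(v)` of the single-target counts;
  `completions_succ_le'` — `N_{t+1} ≤ N_t` along every word (no hitting hypothesis);
* `completionsIn`, `gateWeightIn` — completions / conditional weight for a target finset `K`;
  `gateWeightIn_eq_of_agree` (past-measurable), `sum_gateWeightIn_setPair_le` (conditional sub-probability),
  `prod_gateWeightIn_eq` (telescoping to `1 / Σ_{k ∈ K} levelCount`), `sqrt_div_le_prod_gateWeightIn`
  (product `≥ √(ℓ+1) / (#K · 4^ℓ)` on words whose window pop count lies in `K`).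

Honest framing: elementary counting for ONE ingredient of the exponent-2 rung S11 / the re-method (D*); nothing here bears
on stmt-23918 (∀c), `NNNotVP` or VP ≠ VNP.  Definitions: bookkeeping `completionsIn`, `gateWeightIn`; no named facts.
-/

noncomputable section

-- Sub = Summit single-conjunct layout: the duplicated namespace component is mandated by the tree.
set_option linter.dupNamespace false

namespace Summit.ValiantsHypothesis.ValiantsHypothesis.Theorems.FifoMatching.NNLinearDegreeCofactorHard.GateWeight

open Finset

variable {J : ℕ}

/-! ### Two more facts about the single-target counts -/

/-- **The recursion of the completion counts**: summing the count after pair `s+t` over the four codes of that pair gives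
the count before it (no hitting hypothesis). [folklore] -/
theorem sum_completions_setPair (κ : ℕ → Bool) (s ℓ k t : ℕ) (ht : t < ℓ) (hJ : 2 * (s + t) + 1 < 2 * J)
    (v : Fin (2 * J) → Bool) :
    ∑ c : Bool × Bool, completions κ s ℓ k (t + 1) (fun i : Fin (2 * J) =>
        if i.val = 2 * (s + t) then c.1 else if i.val = 2 * (s + t) + 1 then c.2 else v i)
      = completions κ s ℓ k t v := by
  set F : Bool × Bool → (Fin (2 * J) → Bool) := fun c i =>
    if i.val = 2 * (s + t) then c.1 else if i.val = 2 * (s + t) + 1 then c.2 else v i with hF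
  show ∑ c : Bool × Bool, completions κ s ℓ k (t + 1) (F c) = completions κ s ℓ k t v
  have hagree : ∀ c, ∀ i : Fin (2 * J), i.val < 2 * (s + t) → F c i = v i := by
    intro c i hi
    simp only [hF]
    rw [if_neg (by omega), if_neg (by omega)]
  have hlt0 : 2 * (s + t) < 2 * J := by omega
  have hne : 2 * (s + t) + 1 ≠ 2 * (s + t) := by omega
  have hbit0 : ∀ c : Bool × Bool, bit (F c) (2 * (s + t)) = c.1 := by
    intro c
    unfold bit; rw [dif_pos hlt0]
    show (if (2 * (s + t) = 2 * (s + t)) then c.1 else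
      if (2 * (s + t) = 2 * (s + t) + 1) then c.2 else v ⟨2 * (s + t), hlt0⟩) = c.1
    rw [if_pos rfl]
  have hbit1 : ∀ c : Bool × Bool, bit (F c) (2 * (s + t) + 1) = c.2 := by
    intro c
    unfold bit; rw [dif_pos hJ]
    show (if (2 * (s + t) + 1 = 2 * (s + t)) then c.1 else
      if (2 * (s + t) + 1 = 2 * (s + t) + 1) then c.2 else v ⟨2 * (s + t) + 1, hJ⟩) = c.2
    rw [if_neg hne, if_pos rfl]
  have hP : ∀ c : Bool × Bool, popPrefix κ s (t + 1) (F c) = popPrefix κ s t v + popPair (κ (s + t)) c.1 c.2 := by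
    intro c
    rw [popPrefix_succ, popPrefix_eq_of_agree κ s t (hagree c), hbit0, hbit1]
  by_cases hle : popPrefix κ s t v ≤ k
  · unfold completions
    rw [if_pos hle, kinds_eq_cons κ s ℓ t ht, levelCount]
    refine sum_congr rfl fun c _ => ?_
    rw [hP c]
    by_cases hc : popPair (κ (s + t)) c.1 c.2 ≤ k - popPrefix κ s t v
    · rw [if_pos (by omega), if_pos hc]
      congr 1
      omega
    · rw [if_neg (by omega), if_neg hc]
  · unfold completions
    rw [if_neg hle]
    refine sum_eq_zero fun c _ => ?_
    rw [hP c, if_neg (by omega)]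

/-- The completion counts are non-increasing along every word. [folklore] -/
theorem completions_succ_le' (κ : ℕ → Bool) (s ℓ k : ℕ) (v : Fin (2 * J) → Bool) {t : ℕ} (ht : t < ℓ) :
    completions κ s ℓ k (t + 1) v ≤ completions κ s ℓ k t v := by
  by_cases hle1 : popPrefix κ s (t + 1) v ≤ k
  · have hle0 : popPrefix κ s t v ≤ k := le_trans (by rw [popPrefix_succ]; omega) hle1
    unfold completions
    rw [if_pos hle1, if_pos hle0, kinds_eq_cons κ s ℓ t ht]
    have := levelCount_cons_ge (κ (s + t)) (kinds κ s ℓ (t + 1)) (k := k - popPrefix κ s t v)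
      (bit v (2 * (s + t))) (bit v (2 * (s + t) + 1)) (by rw [popPrefix_succ] at hle1; omega)
    rw [popPrefix_succ]
    convert this using 2
    omega
  · unfold completions
    rw [if_neg hle1]
    exact Nat.zero_le _

/-! ### Target sets -/

/-- The number of admissible completions for a target SET `K` of window pop counts. [folklore] -/
def completionsIn (κ : ℕ → Bool) (s ℓ : ℕ) (K : Finset ℕ) (t : ℕ) (v : Fin (2 * J) → Bool) : ℕ :=
  ∑ k ∈ K, completions κ s ℓ k t v

/-- The gate weight of pair `s+t` for the target set `K`. [folklore] -/
def gateWeightIn (κ : ℕ → Bool) (s ℓ : ℕ) (K : Finset ℕ) (t : ℕ) (v : Fin (2 * J) → Bool) : ℝ :=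
  if completionsIn κ s ℓ K t v = 0 then 0
  else (completionsIn κ s ℓ K (t + 1) v : ℝ) / (completionsIn κ s ℓ K t v : ℝ)

/-- Nonnegativity. [folklore] -/
theorem gateWeightIn_nonneg (κ : ℕ → Bool) (s ℓ : ℕ) (K : Finset ℕ) (t : ℕ) (v : Fin (2 * J) → Bool) :
    0 ≤ gateWeightIn κ s ℓ K t v := by unfold gateWeightIn; split_ifs <;> positivity

/-- **Past-measurability** (bits `< 2(s+t)+2`). [folklore] -/
theorem gateWeightIn_eq_of_agree (κ : ℕ → Bool) (s ℓ : ℕ) (K : Finset ℕ) (t : ℕ) {v w : Fin (2 * J) → Bool}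
    (h : ∀ i : Fin (2 * J), i.val < 2 * (s + t) + 2 → v i = w i) :
    gateWeightIn κ s ℓ K t v = gateWeightIn κ s ℓ K t w := by
  have h0 : completionsIn κ s ℓ K t v = completionsIn κ s ℓ K t w :=
    sum_congr rfl fun k _ => completions_eq_of_agree κ s ℓ k t (fun i hi => h i (by omega))
  have h1 : completionsIn κ s ℓ K (t + 1) v = completionsIn κ s ℓ K (t + 1) w :=
    sum_congr rfl fun k _ => completions_eq_of_agree κ s ℓ k (t + 1) (fun i hi => h i (by omega))
  unfold gateWeightIn
  rw [h0, h1]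

/-- **Conditional sub-probability** for target sets. [folklore] -/
theorem sum_gateWeightIn_setPair_le (κ : ℕ → Bool) (s ℓ : ℕ) (K : Finset ℕ) (t : ℕ) (ht : t < ℓ)
    (hJ : 2 * (s + t) + 1 < 2 * J) (v : Fin (2 * J) → Bool) :
    ∑ c : Bool × Bool, gateWeightIn κ s ℓ K t (fun i : Fin (2 * J) =>
        if i.val = 2 * (s + t) then c.1 else if i.val = 2 * (s + t) + 1 then c.2 else v i) ≤ 1 := by
  set F : Bool × Bool → (Fin (2 * J) → Bool) := fun c i =>
    if i.val = 2 * (s + t) then c.1 else if i.val = 2 * (s + t) + 1 then c.2 else v i with hF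
  show ∑ c : Bool × Bool, gateWeightIn κ s ℓ K t (F c) ≤ 1
  have hagree : ∀ c, ∀ i : Fin (2 * J), i.val < 2 * (s + t) → F c i = v i := by
    intro c i hi
    simp only [hF]
    rw [if_neg (by omega), if_neg (by omega)]
  have hCt : ∀ c, completionsIn κ s ℓ K t (F c) = completionsIn κ s ℓ K t v := fun c =>
    sum_congr rfl fun k _ => completions_eq_of_agree κ s ℓ k t (hagree c)
  by_cases h0 : completionsIn κ s ℓ K t v = 0
  · have : ∀ c, gateWeightIn κ s ℓ K t (F c) = 0 := by
      intro c; unfold gateWeightIn; rw [hCt c, if_pos h0]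
    simp only [this, sum_const_zero]
    exact zero_le_one
  · have hsum : ∑ c : Bool × Bool, (completionsIn κ s ℓ K (t + 1) (F c) : ℝ) = completionsIn κ s ℓ K t v := by
      rw [← Nat.cast_sum]
      congr 1
      unfold completionsIn
      rw [sum_comm]
      refine sum_congr rfl fun k _ => ?_
      exact sum_completions_setPair κ s ℓ k t ht hJ v
    have hpos : (0 : ℝ) < completionsIn κ s ℓ K t v := by exact_mod_cast Nat.pos_of_ne_zero h0
    have : ∑ c : Bool × Bool, gateWeightIn κ s ℓ K t (F c)
        = (∑ c : Bool × Bool, (completionsIn κ s ℓ K (t + 1) (F c) : ℝ)) / completionsIn κ s ℓ K t v := by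
      rw [sum_div]
      refine sum_congr rfl fun c _ => ?_
      unfold gateWeightIn
      rw [hCt c, if_neg h0]
    rw [this, hsum, div_self hpos.ne']

/-- At the end of the window the set-completion count of a hitting word is `1`. [folklore] -/
theorem completionsIn_self (κ : ℕ → Bool) (s ℓ : ℕ) (K : Finset ℕ) (v : Fin (2 * J) → Bool)
    (hk : popPrefix κ s ℓ v ∈ K) : completionsIn κ s ℓ K ℓ v = 1 := by
  unfold completionsIn
  rw [← Finset.sum_erase_add _ _ hk, completions_self κ s ℓ _ v rfl]
  have : ∑ k ∈ K.erase (popPrefix κ s ℓ v), completions κ s ℓ k ℓ v = 0 := by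
    refine sum_eq_zero fun k hk' => ?_
    have hne : k ≠ popPrefix κ s ℓ v := (mem_erase.1 hk').1
    unfold completions kinds
    split_ifs with hle
    · rw [Nat.sub_self, List.range'_zero, List.map_nil, levelCount, if_neg (by omega)]
    · rfl
  rw [this, zero_add]

/-- Positivity of the set-completion counts along a hitting word. [folklore] -/
theorem completionsIn_pos (κ : ℕ → Bool) (s ℓ : ℕ) (K : Finset ℕ) (v : Fin (2 * J) → Bool)
    (hk : popPrefix κ s ℓ v ∈ K) {t : ℕ} (ht : t ≤ ℓ) : 0 < completionsIn κ s ℓ K t v := by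
  unfold completionsIn
  exact lt_of_lt_of_le (completions_pos κ s ℓ _ v rfl ht)
    (single_le_sum (f := fun k => completions κ s ℓ k t v) (fun _ _ => Nat.zero_le _) hk)

/-- **Telescoping** for target sets: on a word whose window pop count lies in `K`, the product of the weights is
`1 / Σ_{k ∈ K} levelCount`. [folklore] -/
theorem prod_gateWeightIn_eq (κ : ℕ → Bool) (s ℓ : ℕ) (K : Finset ℕ) (v : Fin (2 * J) → Bool)
    (hk : popPrefix κ s ℓ v ∈ K) :
    ∏ t ∈ range ℓ, gateWeightIn κ s ℓ K t v = 1 / (completionsIn κ s ℓ K 0 v : ℝ) := by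
  have hpos : ∀ t ≤ ℓ, (0 : ℝ) < completionsIn κ s ℓ K t v := fun t ht => by
    exact_mod_cast completionsIn_pos κ s ℓ K v hk ht
  have key : ∀ u ≤ ℓ, ∏ t ∈ range u, gateWeightIn κ s ℓ K t v
      = (completionsIn κ s ℓ K u v : ℝ) / completionsIn κ s ℓ K 0 v := by
    intro u hu
    induction u with
    | zero => rw [prod_range_zero, div_self (hpos 0 (Nat.zero_le _)).ne']
    | succ u ih =>
      rw [prod_range_succ, ih (by omega)]
      have hu0 : (completionsIn κ s ℓ K u v : ℝ) ≠ 0 := (hpos u (by omega)).ne'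
      have hne : completionsIn κ s ℓ K u v ≠ 0 := by exact_mod_cast hu0
      unfold gateWeightIn
      rw [if_neg hne, div_mul_div_comm, mul_comm (completionsIn κ s ℓ K u v : ℝ), mul_div_mul_right _ _ hu0]
  rw [key ℓ le_rfl, completionsIn_self κ s ℓ K v hk, Nat.cast_one]

/-- **The price of a passed gate with a target set**: the product of the weights is `≥ √(ℓ+1) / (#K · 4^ℓ)` on words whose
window pop count lies in `K` — a factor `√(ℓ+1)/#K` above the free-pair weight `4^{-ℓ}`. [folklore] -/
theorem sqrt_div_le_prod_gateWeightIn (κ : ℕ → Bool) (s ℓ : ℕ) (K : Finset ℕ) (v : Fin (2 * J) → Bool)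
    (hk : popPrefix κ s ℓ v ∈ K) :
    Real.sqrt (ℓ + 1) / (K.card * 4 ^ ℓ) ≤ ∏ t ∈ range ℓ, gateWeightIn κ s ℓ K t v := by
  rw [prod_gateWeightIn_eq κ s ℓ K v hk]
  have hlen : (kinds κ s ℓ 0).length = ℓ := by simp [kinds]
  have hKpos : 0 < K.card := card_pos.2 ⟨_, hk⟩
  have hNpos : (0 : ℝ) < completionsIn κ s ℓ K 0 v := by
    exact_mod_cast completionsIn_pos κ s ℓ K v hk (Nat.zero_le ℓ)
  have h4 : (0 : ℝ) < 4 ^ ℓ := by positivity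
  have hKr : (0 : ℝ) < K.card := by exact_mod_cast hKpos
  -- each level count is `≤ 4^ℓ / √(ℓ+1)`
  have hlevel : ∀ k, Real.sqrt (ℓ + 1) * (levelCount (kinds κ s ℓ 0) k : ℝ) ≤ 4 ^ ℓ := by
    intro k
    have hsq : ((ℓ : ℝ) + 1) * (levelCount (kinds κ s ℓ 0) k : ℝ) ^ 2 ≤ (16 : ℝ) ^ ℓ := by
      have := succ_mul_levelCount_sq_le (kinds κ s ℓ 0) k
      rw [hlen] at this
      exact_mod_cast this
    have h16 : (16 : ℝ) ^ ℓ = (4 ^ ℓ) ^ 2 := by rw [← pow_mul, mul_comm, pow_mul]; norm_num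
    rw [h16] at hsq
    have hnn : 0 ≤ Real.sqrt (ℓ + 1) * (levelCount (kinds κ s ℓ 0) k : ℝ) := by positivity
    have hsq' : (Real.sqrt (ℓ + 1) * (levelCount (kinds κ s ℓ 0) k : ℝ)) ^ 2 ≤ (4 ^ ℓ) ^ 2 := by
      rw [mul_pow, Real.sq_sqrt (by positivity)]
      exact hsq
    exact (pow_le_pow_iff_left₀ hnn h4.le two_ne_zero).1 hsq'
  -- sum over the target set
  have hmain : Real.sqrt (ℓ + 1) * (completionsIn κ s ℓ K 0 v : ℝ) ≤ K.card * 4 ^ ℓ := by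
    unfold completionsIn
    rw [Nat.cast_sum, mul_sum]
    calc ∑ k ∈ K, Real.sqrt (ℓ + 1) * (completions κ s ℓ k 0 v : ℝ)
        ≤ ∑ _k ∈ K, (4 : ℝ) ^ ℓ := sum_le_sum fun k _ => by rw [completions_zero]; exact hlevel k
      _ = K.card * 4 ^ ℓ := by rw [sum_const, nsmul_eq_mul]
  rw [div_le_div_iff₀ (mul_pos hKr h4) hNpos, one_mul]
  exact hmain

end Summit.ValiantsHypothesis.ValiantsHypothesis.Theorems.FifoMatching.NNLinearDegreeCofactorHard.GateWeight

end
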